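import Mathlib
import Summits.MatrixMultiplication.MatrixMultiplication.Theorems.LevelGradedCohnUmansLevelOneGL2DesignsStubTangencySetsHermitianDescent

/-!
# Stub `stub_tangencySets` (crux `LevelOneGL2Designs`, stmt-MatrixMultiplication-14080) —
wall-breaker axis 7/12 "Hermitian unital constructions", generation 1:
Baer subplanes in GENERAL position see at most `2q` points of any Hermitian unital

The stub asks for tangency sets of `AG(2,p)` (`p` PRIME) with `c·p^{3/2}` points.  The only
configurations of that size in any finite plane are the unitals of square-order planes, and the
axis' construction `FlagLine.TangencyHermitian.hermitian_srs` realises the stub verbatim over every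
field of order `q²`.  The natural transfer to the stub's own plane is DESCENT: `AG(2,p)` sits inside
`AG(2,p²)` as a Baer subplane, so one may move the unital by an arbitrary collineation of
`PG(2,p²)` and keep the flags whose point is `𝔽_p`-rational.  Part 1 of the sibling seat k1
(`HermitianUnital.card_hermitian_fixed_le`) computed this for the unital in STANDARD position
(`b + b^q = a^q a` meets the subplane in the conic `2b = a²`, `≤ q` points).  This file settles
ALL positions at once, by an argument that does not even use the Hermitian symmetry:

* `det_eq_zero_of_alternating` — a `3 × 3` alternating matrix is singular;
* `card_grid_quadric_le` — for ANY field `F`, any `H : Matrix (Fin 3) (Fin 3) F` with `det H ≠ 0`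
  and any finite `K ⊆ F`, at most `2·|K|` points `(a,b) ∈ K × K` satisfy `xᵀ H x = 0`,
  `x = (a,b,1)` (the form is a non-zero polynomial of degree `≤ 2` on the grid, since the zero
  form would make `H` alternating; then count fibre by fibre);
* `card_sesq_fixed_le` — hence for any map `σ : F → F` fixing `K` pointwise (and `1`), at most
  `2·|K|` points of `K × K` are isotropic for the `σ`-sesquilinear form `Σ H i j · xᵢ · σ(xⱼ)`:
  on `σ`-fixed vectors the sesquilinear form IS the quadratic form `xᵀ H x`;
* `card_hermitian_baerSection_le` — in particular, if `|F| = q²` and `σ = (·)^q`, every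
  non-degenerate Hermitian (indeed every non-degenerate sesquilinear) curve
  `{x : Σ H i j xᵢ xⱼ^q = 0}` has at most `2q` affine points with both coordinates in the subfield
  `{c : c^q = c}` — versus the `q³` affine points of the curve itself
  (`FlagLine.TangencyHermitian.card_hermitian`).

Reading for the stub.  The images of the classical unital under the collineation group
`PΓL(3,q²)` are exactly the curves of the non-degenerate Hermitian matrices `H` (a linear
substitution `g` replaces `H` by `gᵀ H g^{(q)}`, a field automorphism by an entrywise conjugate; both
keep `det ≠ 0`), and `PΓL(3,q²)` is transitive on Baer subplanes; so the theorem says: **no Baer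
subplane of `PG(2,q²)` contains more than `2q + 1` points of any Hermitian unital** (`2q` affine
ones here; classically `|B ∩ U| ∈ {1, q+1, 2q+1}`), i.e. descent from the square-order model to the
prime field keeps `O(p)` of the `p³` flags whatever the position — exponent `1`, as for the conic.
Together with the symmetric classifications of the sibling files (unitary circles, norm pencils,
unipotent symmetries ⇒ Paley cliques) and Baer's polarity theorem (companion file
`…TangencyPolarity` of this seat: `p + 1` absolute points in ANY plane of prime order), this closes
the Hermitian axis over `ZMod p`; the prime-order statement is the open frontier
`IM(2,p) ≍ p^{3/2}` infinitely often (Pohoata 2026 gives `p^{3/2−ε}`).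
Elementary (root counting for quadratics, `Matrix.det_fin_three`); Mathlib plus
`HermitianUnital.card_powFixed_le` of the sibling descent file; no definitions.
-/

-- `Summit.MatrixMultiplication.MatrixMultiplication.…` is the tree's mandated summit/problem namespace (D-0017).
set_option linter.dupNamespace false

namespace Summit.MatrixMultiplication.MatrixMultiplication.Theorems.LevelOneGL2Designs.BaerSubplane

open Finset Matrix Polynomial

section Alternating

variable {R : Type*} [CommRing R]

/-- A `3 × 3` alternating matrix (zero diagonal, `H j i = -H i j`) has determinant `0`
(odd-size alternating matrices are singular; here by direct expansion). [elementary] -/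
theorem det_eq_zero_of_alternating (H : Matrix (Fin 3) (Fin 3) R)
    (hdiag : ∀ i, H i i = 0) (hskew : ∀ i j, H j i = -H i j) : H.det = 0 := by
  rw [Matrix.det_fin_three]
  have h10 : H 1 0 = -H 0 1 := hskew 0 1
  have h20 : H 2 0 = -H 0 2 := hskew 0 2
  have h21 : H 2 1 = -H 1 2 := hskew 1 2
  rw [h10, h20, h21, hdiag 0, hdiag 1, hdiag 2]
  ring

end Alternating

section Quadric

variable {F : Type*} [Field F] [DecidableEq F]

/-- A non-zero polynomial `c₂ b² + c₁ b + c₀` has at most two roots in any finite set `K`.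
[elementary; `Polynomial.card_roots'`] -/
theorem card_filter_quadratic_le_two (K : Finset F) (c₂ c₁ c₀ : F)
    (h : c₂ ≠ 0 ∨ c₁ ≠ 0 ∨ c₀ ≠ 0) :
    (K.filter fun b => c₂ * b ^ 2 + c₁ * b + c₀ = 0).card ≤ 2 := by
  set P : F[X] := C c₂ * X ^ 2 + C c₁ * X + C c₀ with hPdef
  have hP : P ≠ 0 := by
    intro hP0
    have h2 : P.coeff 2 = c₂ := by simp [hPdef]
    have h1 : P.coeff 1 = c₁ := by simp [hPdef, coeff_X_pow]
    have h0 : P.coeff 0 = c₀ := by simp [hPdef]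
    rw [hP0, coeff_zero] at h2 h1 h0
    rcases h with h | h | h
    · exact h h2.symm
    · exact h h1.symm
    · exact h h0.symm
  have hdeg : P.natDegree ≤ 2 := by
    rw [hPdef]
    refine (natDegree_add_le _ _).trans (max_le ((natDegree_add_le _ _).trans (max_le ?_ ?_)) ?_)
    · exact (natDegree_C_mul_le _ _).trans (natDegree_X_pow_le 2)
    · exact (natDegree_C_mul_le _ _).trans (natDegree_X_le.trans (by norm_num))
    · simp
  calc (K.filter fun b => c₂ * b ^ 2 + c₁ * b + c₀ = 0).card ≤ P.roots.toFinset.card := by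
        refine Finset.card_le_card fun b hb => ?_
        simp only [Finset.mem_filter] at hb
        rw [Multiset.mem_toFinset, mem_roots hP]
        simp [hPdef, hb.2]
    _ ≤ Multiset.card P.roots := Multiset.toFinset_card_le _
    _ ≤ P.natDegree := card_roots' P
    _ ≤ 2 := hdeg

/-- A genuinely linear equation `c₁ b + c₀ = 0`, `c₁ ≠ 0`, has at most one root in `K`.
[elementary] -/
theorem card_filter_linear_le_one (K : Finset F) (c₁ c₀ : F) (h : c₁ ≠ 0) :
    (K.filter fun b => c₁ * b + c₀ = 0).card ≤ 1 := by
  refine Finset.card_le_one.mpr fun b hb b' hb' => ?_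
  simp only [Finset.mem_filter] at hb hb'
  have : c₁ * (b - b') = 0 := by linear_combination hb.2 - hb'.2
  rcases mul_eq_zero.mp this with h0 | h0
  · exact (h h0).elim
  · exact sub_eq_zero.mp h0

omit [DecidableEq F] in
/-- The ternary form `xᵀ H x` at `x = (a, b, 1)`, written out. [bookkeeping] -/
theorem sum_form_eq (H : Matrix (Fin 3) (Fin 3) F) (a b : F) :
    (∑ i, ∑ j, H i j * ![a, b, 1] i * ![a, b, 1] j) =
      H 1 1 * b ^ 2 + ((H 0 1 + H 1 0) * a + (H 1 2 + H 2 1)) * b +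
        (H 0 0 * a ^ 2 + (H 0 2 + H 2 0) * a + H 2 2) := by
  simp only [Fin.sum_univ_three, Matrix.cons_val_zero, Matrix.cons_val_one, Matrix.cons_val]
  ring

/-- **Grid points of a non-degenerate ternary form lie on a non-zero conic: at most `2|K|`.**
For any field `F`, any `H : Matrix (Fin 3) (Fin 3) F` with `det H ≠ 0` and any finite `K ⊆ F`,
at most `2·|K|` pairs `(a,b) ∈ K × K` satisfy `xᵀ H x = 0` with `x = (a,b,1)`.  (If the
polynomial `xᵀ H x` restricted to `z = 1` were zero, `H` would be alternating, hence singular;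
otherwise count the zeros fibre by fibre over `a`.) [elementary] -/
theorem card_grid_quadric_le (H : Matrix (Fin 3) (Fin 3) F) (hH : H.det ≠ 0) (K : Finset F) :
    ((K ×ˢ K).filter fun ab : F × F =>
        (∑ i, ∑ j, H i j * ![ab.1, ab.2, 1] i * ![ab.1, ab.2, 1] j) = 0).card ≤ 2 * K.card := by
  -- fibrewise description of the count: `f a` = number of zeros `b ∈ K` above `a`
  set f : F → ℕ := fun a => (K.filter fun b => H 1 1 * b ^ 2 +
      ((H 0 1 + H 1 0) * a + (H 1 2 + H 2 1)) * b + (H 0 0 * a ^ 2 + (H 0 2 + H 2 0) * a + H 2 2)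
        = 0).card with hf
  have hcount : ((K ×ˢ K).filter fun ab : F × F =>
      (∑ i, ∑ j, H i j * ![ab.1, ab.2, 1] i * ![ab.1, ab.2, 1] j) = 0).card = ∑ a ∈ K, f a := by
    rw [Finset.card_filter, Finset.sum_product]
    refine Finset.sum_congr rfl fun a _ => ?_
    simp only [hf, Finset.card_filter]
    refine Finset.sum_congr rfl fun b _ => ?_
    rw [sum_form_eq]
  rw [hcount]
  have hfK : ∀ a, f a ≤ K.card := fun a => Finset.card_filter_le _ _
  by_cases h2 : H 1 1 ≠ 0
  · -- every fibre is a genuine quadratic: at most two zeros each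
    calc ∑ a ∈ K, f a ≤ ∑ a ∈ K, 2 :=
          Finset.sum_le_sum fun a _ => card_filter_quadratic_le_two K _ _ _ (Or.inl h2)
      _ = 2 * K.card := by rw [Finset.sum_const, smul_eq_mul, mul_comm]
  push Not at h2
  by_cases hα0 : H 0 1 + H 1 0 ≠ 0
  · -- the linear coefficient vanishes for at most one `a₀`; elsewhere at most one zero
    set a₀ : F := -(H 1 2 + H 2 1) / (H 0 1 + H 1 0) with ha₀
    have hlin : ∀ a, a ≠ a₀ → (H 0 1 + H 1 0) * a + (H 1 2 + H 2 1) ≠ 0 := by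
      intro a ha h0
      apply ha
      rw [ha₀, eq_div_iff hα0]
      linear_combination h0
    have hle : ∀ a ∈ K, f a ≤ 1 + (if a = a₀ then K.card else 0) := by
      intro a _
      by_cases ha : a = a₀
      · rw [if_pos ha]
        exact (hfK a).trans (Nat.le_add_left _ _)
      · rw [if_neg ha, add_zero]
        have heq : (K.filter fun b => H 1 1 * b ^ 2 +
            ((H 0 1 + H 1 0) * a + (H 1 2 + H 2 1)) * b +
              (H 0 0 * a ^ 2 + (H 0 2 + H 2 0) * a + H 2 2) = 0) =
            K.filter fun b => ((H 0 1 + H 1 0) * a + (H 1 2 + H 2 1)) * b +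
              (H 0 0 * a ^ 2 + (H 0 2 + H 2 0) * a + H 2 2) = 0 := by
          refine Finset.filter_congr fun b _ => ?_
          rw [h2, zero_mul, zero_add]
        change (K.filter fun b => H 1 1 * b ^ 2 +
            ((H 0 1 + H 1 0) * a + (H 1 2 + H 2 1)) * b +
              (H 0 0 * a ^ 2 + (H 0 2 + H 2 0) * a + H 2 2) = 0).card ≤ 1
        rw [heq]
        exact card_filter_linear_le_one K _ _ (hlin a ha)
    calc ∑ a ∈ K, f a ≤ ∑ a ∈ K, (1 + (if a = a₀ then K.card else 0)) := Finset.sum_le_sum hle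
      _ = K.card + (if a₀ ∈ K then K.card else 0) := by
          rw [Finset.sum_add_distrib, Finset.sum_const, smul_eq_mul, mul_one, Finset.sum_ite_eq']
      _ ≤ K.card + K.card := by split_ifs <;> omega
      _ = 2 * K.card := by ring
  push Not at hα0
  by_cases hβ0 : H 1 2 + H 2 1 ≠ 0
  · -- constant non-zero linear coefficient: every fibre has at most one zero
    have hle : ∀ a ∈ K, f a ≤ 1 := by
      intro a _
      have heq : (K.filter fun b => H 1 1 * b ^ 2 +
          ((H 0 1 + H 1 0) * a + (H 1 2 + H 2 1)) * b +
            (H 0 0 * a ^ 2 + (H 0 2 + H 2 0) * a + H 2 2) = 0) =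
          K.filter fun b => (H 1 2 + H 2 1) * b +
            (H 0 0 * a ^ 2 + (H 0 2 + H 2 0) * a + H 2 2) = 0 := by
        refine Finset.filter_congr fun b _ => ?_
        rw [h2, hα0, zero_mul, zero_add, zero_mul, zero_add]
      change (K.filter fun b => H 1 1 * b ^ 2 +
          ((H 0 1 + H 1 0) * a + (H 1 2 + H 2 1)) * b +
            (H 0 0 * a ^ 2 + (H 0 2 + H 2 0) * a + H 2 2) = 0).card ≤ 1
      rw [heq]
      exact card_filter_linear_le_one K _ _ hβ0
    calc ∑ a ∈ K, f a ≤ ∑ a ∈ K, 1 := Finset.sum_le_sum hle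
      _ = K.card := by rw [Finset.sum_const, smul_eq_mul, mul_one]
      _ ≤ 2 * K.card := by omega
  push Not at hβ0
  -- the form no longer depends on `b`: fibres are all-or-nothing, governed by the `a`-part,
  -- which is a non-zero polynomial because `H` is not alternating
  have hγne : H 0 0 ≠ 0 ∨ (H 0 2 + H 2 0) ≠ 0 ∨ H 2 2 ≠ 0 := by
    by_contra hcon
    push Not at hcon
    obtain ⟨h00, h02, h22⟩ := hcon
    apply hH
    apply det_eq_zero_of_alternating
    · intro i
      fin_cases i
      · exact h00
      · exact h2
      · exact h22
    · intro i j
      fin_cases i <;> fin_cases j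
      · simp [h00]
      · exact eq_neg_of_add_eq_zero_right hα0
      · exact eq_neg_of_add_eq_zero_right h02
      · exact eq_neg_of_add_eq_zero_left hα0
      · simp [h2]
      · exact eq_neg_of_add_eq_zero_right hβ0
      · exact eq_neg_of_add_eq_zero_left h02
      · exact eq_neg_of_add_eq_zero_left hβ0
      · simp [h22]
  have hfa : ∀ a ∈ K, f a =
      if H 0 0 * a ^ 2 + (H 0 2 + H 2 0) * a + H 2 2 = 0 then K.card else 0 := by
    intro a _
    have heq : (K.filter fun b => H 1 1 * b ^ 2 +
        ((H 0 1 + H 1 0) * a + (H 1 2 + H 2 1)) * b +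
          (H 0 0 * a ^ 2 + (H 0 2 + H 2 0) * a + H 2 2) = 0) =
        K.filter fun _ => H 0 0 * a ^ 2 + (H 0 2 + H 2 0) * a + H 2 2 = 0 := by
      refine Finset.filter_congr fun b _ => ?_
      rw [h2, hα0, hβ0, zero_mul, zero_add, zero_mul, add_zero, zero_mul, zero_add]
    change (K.filter fun b => H 1 1 * b ^ 2 +
        ((H 0 1 + H 1 0) * a + (H 1 2 + H 2 1)) * b +
          (H 0 0 * a ^ 2 + (H 0 2 + H 2 0) * a + H 2 2) = 0).card = _
    rw [heq, Finset.filter_const]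
    split_ifs <;> simp
  calc ∑ a ∈ K, f a
        = ∑ a ∈ K, (if H 0 0 * a ^ 2 + (H 0 2 + H 2 0) * a + H 2 2 = 0 then K.card else 0) :=
          Finset.sum_congr rfl hfa
    _ = (K.filter fun a => H 0 0 * a ^ 2 + (H 0 2 + H 2 0) * a + H 2 2 = 0).card * K.card := by
        rw [Finset.sum_ite, Finset.sum_const_zero, add_zero, Finset.sum_const, smul_eq_mul]
    _ ≤ 2 * K.card :=
        Nat.mul_le_mul_right _ (card_filter_quadratic_le_two K (H 0 0) (H 0 2 + H 2 0) (H 2 2) hγne)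

/-- **Sesquilinear forms on fixed vectors.**  For any map `σ : F → F` with `σ 1 = 1` and any finite
set `K` of `σ`-fixed scalars, at most `2·|K|` points `(a,b) ∈ K × K` are isotropic for the
`σ`-sesquilinear form `Σᵢⱼ H i j · xᵢ · σ(xⱼ)` (`x = (a,b,1)`) of a matrix with `det H ≠ 0`: on such
points it coincides with the quadratic form `xᵀ H x` of `card_grid_quadric_le`. [elementary] -/
theorem card_sesq_fixed_le (σ : F → F) (h1 : σ 1 = 1) (K : Finset F) (hK : ∀ a ∈ K, σ a = a)
    (H : Matrix (Fin 3) (Fin 3) F) (hH : H.det ≠ 0) :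
    ((K ×ˢ K).filter fun ab : F × F =>
        (∑ i, ∑ j, H i j * ![ab.1, ab.2, 1] i * σ (![ab.1, ab.2, 1] j)) = 0).card ≤ 2 * K.card := by
  have heq : ((K ×ˢ K).filter fun ab : F × F =>
        (∑ i, ∑ j, H i j * ![ab.1, ab.2, 1] i * σ (![ab.1, ab.2, 1] j)) = 0) =
      (K ×ˢ K).filter fun ab : F × F =>
        (∑ i, ∑ j, H i j * ![ab.1, ab.2, 1] i * ![ab.1, ab.2, 1] j) = 0 := by
    refine Finset.filter_congr fun ab hab => ?_
    rw [Finset.mem_product] at hab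
    have hσ : ∀ j, σ (![ab.1, ab.2, 1] j) = ![ab.1, ab.2, 1] j := by
      intro j
      fin_cases j
      · exact hK _ hab.1
      · exact hK _ hab.2
      · exact h1
    simp_rw [hσ]
  rw [heq]
  exact card_grid_quadric_le H hH K

end Quadric

section Hermitian

variable {F : Type*} [Field F] [Fintype F] [DecidableEq F]

open Summit.MatrixMultiplication.MatrixMultiplication.Theorems.LevelOneGL2Designs.HermitianUnital
  (card_powFixed_le)

/-- **Every Baer subplane meets every Hermitian unital in at most `2q` affine points.**  Let
`|F| = q²`.  For every `H : Matrix (Fin 3) (Fin 3) F` with `det H ≠ 0` — in particular every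
non-degenerate Hermitian matrix, i.e. every image of the classical unital under a collineation of
`PG(2,q²)` — at most `2q` affine points `(a,b)` of the curve `Σᵢⱼ H i j xᵢ xⱼ^q = 0`
(`x = (a,b,1)`) have both coordinates in the subfield `{c : c^q = c}` of order `q`, the Baer
subplane over which `stub_tangencySets` is stated when `q = p` is prime.  Compare
`FlagLine.TangencyHermitian.card_hermitian` (`q³` points in all) and the standard-position count
`HermitianUnital.card_hermitian_fixed_le` (`≤ q`). [elementary; the classical statement is
`|B ∩ U| ∈ {1, q+1, 2q+1}` for a Baer subplane `B` and a classical unital `U` of `PG(2,q²)`] -/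
theorem card_hermitian_baerSection_le (q : ℕ) (hF : Fintype.card F = q ^ 2)
    (H : Matrix (Fin 3) (Fin 3) F) (hH : H.det ≠ 0) :
    (univ.filter fun ab : F × F =>
        (∑ i, ∑ j, H i j * ![ab.1, ab.2, 1] i * (![ab.1, ab.2, 1] j) ^ q) = 0 ∧
          ab.1 ^ q = ab.1 ∧ ab.2 ^ q = ab.2).card ≤ 2 * q := by
  have hq : 1 < q := by
    have h1 : 1 < Fintype.card F := Fintype.one_lt_card
    rw [hF] at h1
    by_contra h
    have hq1 : q ≤ 1 := not_lt.mp h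
    have : q ^ 2 ≤ 1 := by
      calc q ^ 2 ≤ 1 ^ 2 := Nat.pow_le_pow_left hq1 2
        _ = 1 := one_pow 2
    omega
  set K : Finset F := univ.filter fun c : F => c ^ q = c with hKdef
  have hK : ∀ a ∈ K, a ^ q = a := fun a ha => (Finset.mem_filter.mp ha).2
  have hsub : (univ.filter fun ab : F × F =>
        (∑ i, ∑ j, H i j * ![ab.1, ab.2, 1] i * (![ab.1, ab.2, 1] j) ^ q) = 0 ∧
          ab.1 ^ q = ab.1 ∧ ab.2 ^ q = ab.2) =
      (K ×ˢ K).filter fun ab : F × F =>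
        (∑ i, ∑ j, H i j * ![ab.1, ab.2, 1] i * (fun c : F => c ^ q) (![ab.1, ab.2, 1] j)) = 0 := by
    ext ab
    simp only [Finset.mem_filter, Finset.mem_univ, true_and, Finset.mem_product, hKdef]
    tauto
  rw [hsub]
  calc _ ≤ 2 * K.card := card_sesq_fixed_le (fun c : F => c ^ q) (one_pow q) K hK H hH
    _ ≤ 2 * q := Nat.mul_le_mul_left 2 (card_powFixed_le q hq)

end Hermitian

end Summit.MatrixMultiplication.MatrixMultiplication.Theorems.LevelOneGL2Designs.BaerSubplane
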